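import Summits.AtomisticToContinuum.Crystallization.Theorems.ChartedZeroExcessLayeredLatticeLiouvilleZH

/-!
# Part ZU «Chart footprints in a Barlow link: letter forcing is combinatorial» (lens-2 g79, NODE 79 rider 4; stand-alone, tree imports only)

The FOOTPRINT of a Barlow bond chart at a vertex `v` of sheet `k` of the Barlow graph `BarlowAdj τ` is the partition of its twelve contact neighbours into
the three of sheet `k+1` (a TRIANGLE), the six of sheet `k` (a hexagon) and the three of sheet `k−1` (a TRIANGLE), and NO contact joins the two triangles
(sheets `k+1` and `k−1` are not adjacent).  This file proves the finite fact behind «a transverse chart sheet forces the letter c» (memo NODE-g79 §11):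

★★★ `chartFootprint_caps_or_c` — in the link of ANY vertex `v` of ANY Barlow graph `BarlowAdj τ`, two vertex-disjoint triangles `{a, b, c}`, `{d, e, f}` of
neighbours of `v` with no adjacency between them ARE the two caps (`{a,b,c}` in sheet `v.1 + 1` and `{d,e,f}` in sheet `v.1 − 1`, or the other way round) —
UNLESS `τ (v.1 − 1) = τ v.1`, i.e. unless `v` is a c-vertex of its own layering (cuboctahedral link; there the three tilted {111} hexagons give three more
footprints).  In particular a second Barlow chart whose sheet through `v` is NOT `v`'s own layer hexagon exists only at c-vertices: an hcp-like vertex is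
charted basally by every chart.  [ENUMERATION `dev/link_enum.py`: cuboctahedral link — 8 triangles, exactly 4 admissible triangle pairs, all of letter type c;
anticuboctahedral link — 8 triangles, exactly 1 (the caps).  Human proof: the caps cap two perfect matchings `M_U`, `M_D` of the equatorial hexagon, equal
(h) or different (c); a cap and a side triangle always touch, two side triangles on the same side share their cap's edge, and an upper side triangle over
`e_u ∈ M_U` and a lower one over `e_d ∈ M_D` avoid each other iff `e_u`, `e_d` are disjoint non-adjacent hexagon edges — impossible inside one matching.]

METHOD.  Relative coordinates: the window of `v` is `{−1, 0, 1} × ℤ²` with letters `α = τ (v.1 − 1)` (step below) and `β = τ v.1` (step above); the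
twelve neighbours are coded by `Fin 12` (`linkSite`: `0–5` in-sheet `(0; loDir i)`, `6–8` the upper cap `(1; −triVert β i)`, `9–11` the lower cap
`(−1; triVert α i)`);
`BarlowAdj` on the window is the relative adjacency `RelAdj α β` (`barlowAdj_shift_iff`), computed by the `Bool` table `linkAdj` (`relAdjB_iff`); the
triangles are the pairwise-adjacent ordered code triples `linkTris` (48 per letter pair = 8 triangles), and the pair statement `caps_of_noCross` is ONE closed
`Bool` evaluation (`decide`, kernel-checked; no `native_decide`) over `4 × 48 × 48` cases.  Pure combinatorics: no door-set hypothesis enters.  0 sorry.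
-/

namespace Summit.AtomisticToContinuum.Crystallization.Theorems.ChartedZeroExcessLayeredLatticeLiouville

/-! ## ZU-1  The coded link window of a vertex -/

/-- the twelve neighbours of the vertex `(0; 0)` of the Barlow graph with letter `α` on the step `−1 → 0` and `β` on the step `0 → 1`, coded by `Fin 12`:
codes `0–5` the in-sheet neighbours `(0; loDir i)`, `6–8` the upper cap `(1; −triVert β i)`, `9–11` the lower cap `(−1; triVert α i)`. [this file, g79] -/
def linkSite (α β : Bool) (i : Fin 12) : ℤ × ℤ × ℤ :=
  if h : i.val < 6 then (0, loDir ⟨i.val, h⟩)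
  else if h' : i.val < 9 then (1, -triVert β ⟨i.val - 6, by omega⟩)
  else (-1, triVert α ⟨i.val - 9, by omega⟩)

/-- relative Barlow adjacency in the three-sheet window of the vertex `(0; 0)` (letters `α` below, `β` above sheet `0`); the letter slot of sheet `1` is never
read inside the window. [this file, g79] -/
def RelAdj (α β : Bool) (x y : ℤ × ℤ × ℤ) : Prop :=
  (y.1 = x.1 ∧ LoAdj x.2 y.2) ∨ (y.1 = x.1 + 1 ∧ CrossAdj (if x.1 = -1 then α else β) x.2 y.2) ∨
    (x.1 = y.1 + 1 ∧ CrossAdj (if y.1 = -1 then α else β) y.2 x.2)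

/-- `LoAdj` as a `Bool`. [formal bookkeeping] -/
def loAdjB (p q : ℤ × ℤ) : Bool := (List.finRange 6).any fun k => q = p + loDir k

/-- `CrossAdj` as a `Bool`. [formal bookkeeping] -/
def crossAdjB (τ : Bool) (p q : ℤ × ℤ) : Bool := (List.finRange 3).any fun i => p = q + triVert τ i

/-- `RelAdj` as a `Bool`. [formal bookkeeping] -/
def relAdjB (α β : Bool) (x y : ℤ × ℤ × ℤ) : Bool :=
  (y.1 = x.1 && loAdjB x.2 y.2) || (y.1 = x.1 + 1 && crossAdjB (if x.1 = -1 then α else β) x.2 y.2) ||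
    (x.1 = y.1 + 1 && crossAdjB (if y.1 = -1 then α else β) y.2 x.2)

/-- [formal bookkeeping] -/
theorem loAdjB_iff (p q : ℤ × ℤ) : loAdjB p q = true ↔ LoAdj p q := by
  simp [loAdjB, LoAdj, List.any_eq_true]

/-- [formal bookkeeping] -/
theorem crossAdjB_iff (τ : Bool) (p q : ℤ × ℤ) : crossAdjB τ p q = true ↔ CrossAdj τ p q := by
  simp [crossAdjB, CrossAdj, List.any_eq_true]

/-- [formal bookkeeping] -/
theorem relAdjB_iff (α β : Bool) (x y : ℤ × ℤ × ℤ) : relAdjB α β x y = true ↔ RelAdj α β x y := by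
  simp only [relAdjB, RelAdj, Bool.or_eq_true, Bool.and_eq_true, decide_eq_true_eq, loAdjB_iff, crossAdjB_iff, or_assoc]

/-- the adjacency table of the coded link. [this file, g79] -/
def linkAdj (α β : Bool) (i j : Fin 12) : Bool := relAdjB α β (linkSite α β i) (linkSite α β j)

/-- the triangles of the coded link as ORDERED triples (all orderings), by definition: the pairwise adjacent code triples. [this file, g79] -/
def linkTris (α β : Bool) : List (Fin 12 × Fin 12 × Fin 12) :=
  (List.finRange 12).flatMap fun i => (List.finRange 12).flatMap fun j =>
    ((List.finRange 12).filter fun l => linkAdj α β i j && linkAdj α β i l && linkAdj α β j l).map fun l => (i, j, l)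

/-- a code triple lies in the upper cap `{6, 7, 8}` (sheet `1`). [this file, g79] -/
def upB (t : Fin 12 × Fin 12 × Fin 12) : Bool :=
  (6 ≤ t.1.val && t.1.val ≤ 8) && (6 ≤ t.2.1.val && t.2.1.val ≤ 8) && (6 ≤ t.2.2.val && t.2.2.val ≤ 8)

/-- a code triple lies in the lower cap `{9, 10, 11}` (sheet `−1`). [this file, g79] -/
def loB (t : Fin 12 × Fin 12 × Fin 12) : Bool := 9 ≤ t.1.val && 9 ≤ t.2.1.val && 9 ≤ t.2.2.val

/-- no adjacency between two code triples. [this file, g79] -/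
def crossFreeB (α β : Bool) (t u : Fin 12 × Fin 12 × Fin 12) : Bool :=
  [t.1, t.2.1, t.2.2].all fun x => [u.1, u.2.1, u.2.2].all fun y => !linkAdj α β x y

/-- the number of in-sheet codes (`0–5`) of a code triple. [this file, g79] -/
def eqCount (t : Fin 12 × Fin 12 × Fin 12) : ℕ :=
  (if t.1.val < 6 then 1 else 0) + (if t.2.1.val < 6 then 1 else 0) + (if t.2.2.val < 6 then 1 else 0)

/-! ## ZU-2  The finite facts -/

/-- a triangle of codes is listed (by definition of the list). [formal bookkeeping] -/
theorem mem_linkTris {α β : Bool} {i j l : Fin 12} (hij : linkAdj α β i j = true) (hil : linkAdj α β i l = true)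
    (hjl : linkAdj α β j l = true) : (i, j, l) ∈ linkTris α β := by
  simp [linkTris, List.mem_flatMap, List.mem_filter, hij, hil, hjl]

set_option maxRecDepth 200000 in
/-- ★★ THE FINITE FACT, as ONE `Bool` evaluation over the `4 × 48 × 48` (letters, triangle, triangle) cases: two triangles of the coded link with no adjacency
between them are the two caps — or the letters agree.  [ENUMERATION: 8 triangles per link; cap/side and side/side pairs always touch unless `α = β`.]
[this file, g79] -/
theorem caps_of_noCross_bool : ([true, false].all fun α => [true, false].all fun β => (linkTris α β).all fun t => (linkTris α β).all fun u =>
    !crossFreeB α β t u || (upB t && loB u) || (loB t && upB u) || (α == β)) = true := by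
  decide +kernel

/-- ★★ two triangles of the coded link with no adjacency between them are the two caps — or the letters agree (a c-vertex). [this file, g79] -/
theorem caps_of_noCross (α β : Bool) (t u : Fin 12 × Fin 12 × Fin 12) (ht : t ∈ linkTris α β) (hu : u ∈ linkTris α β)
    (hX : crossFreeB α β t u = true) : (upB t = true ∧ loB u = true) ∨ (loB t = true ∧ upB u = true) ∨ α = β := by
  have h1 := List.all_eq_true.mp caps_of_noCross_bool α (by cases α <;> simp)
  have h2 := List.all_eq_true.mp h1 β (by cases β <;> simp)
  have h4 := List.all_eq_true.mp (List.all_eq_true.mp h2 t ht) u hu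
  rw [hX] at h4
  simp only [Bool.not_true, Bool.false_or, Bool.or_eq_true, Bool.and_eq_true, beq_iff_eq] at h4
  rcases h4 with (h | h) | h
  · exact Or.inl h
  · exact Or.inr (Or.inl h)
  · exact Or.inr (Or.inr h)

set_option maxRecDepth 200000 in
/-- ★ THE PROPAGATION FACTS, as ONE `Bool` evaluation: for two triangles of the coded link with no adjacency between them, (F3) if one is a cap the other is
the opposite cap, and (F2) if they are not the two caps then together they contain at least four in-sheet codes — so the complementary hexagon of the
footprint contains AT MOST TWO in-sheet codes (the tilted {111} hexagons of a c-vertex meet its own layer in an antipodal pair).  These two facts drive the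
sheet-to-sheet and in-sheet PROPAGATION of the cap/transverse alternative (memo §12: a chart registered to ONE layer hexagon is registered to the layering
on the whole window). [this file, g79] -/
theorem link_pairs_bool : ([true, false].all fun α => [true, false].all fun β => (linkTris α β).all fun t => (linkTris α β).all fun u =>
    !crossFreeB α β t u || (((!loB u || upB t) && (!upB u || loB t)) && ((upB t && loB u) || (loB t && upB u) || decide (4 ≤ eqCount t + eqCount u))))
    = true := by
  decide +kernel

/-- (F3) a cross-free partner of the lower cap is the upper cap. [this file, g79] -/
theorem upB_of_noCross_loB (α β : Bool) (t u : Fin 12 × Fin 12 × Fin 12) (ht : t ∈ linkTris α β) (hu : u ∈ linkTris α β)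
    (hX : crossFreeB α β t u = true) (h : loB u = true) : upB t = true := by
  have h1 := List.all_eq_true.mp link_pairs_bool α (by cases α <;> simp)
  have h2 := List.all_eq_true.mp h1 β (by cases β <;> simp)
  have h4 := List.all_eq_true.mp (List.all_eq_true.mp h2 t ht) u hu
  rw [hX, h] at h4
  simp only [Bool.not_true, Bool.false_or, Bool.and_eq_true] at h4
  exact h4.1.1

/-- (F3) a cross-free partner of the upper cap is the lower cap. [this file, g79] -/
theorem loB_of_noCross_upB (α β : Bool) (t u : Fin 12 × Fin 12 × Fin 12) (ht : t ∈ linkTris α β) (hu : u ∈ linkTris α β)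
    (hX : crossFreeB α β t u = true) (h : upB u = true) : loB t = true := by
  have h1 := List.all_eq_true.mp link_pairs_bool α (by cases α <;> simp)
  have h2 := List.all_eq_true.mp h1 β (by cases β <;> simp)
  have h4 := List.all_eq_true.mp (List.all_eq_true.mp h2 t ht) u hu
  rw [hX, h] at h4
  simp only [Bool.not_true, Bool.false_or, Bool.and_eq_true] at h4
  exact h4.1.2

/-- (F2) a cross-free triangle pair other than the cap pair carries at least four in-sheet codes (its complementary hexagon at most two). [this file, g79] -/
theorem four_le_eqCount_of_noCross (α β : Bool) (t u : Fin 12 × Fin 12 × Fin 12) (ht : t ∈ linkTris α β) (hu : u ∈ linkTris α β)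
    (hX : crossFreeB α β t u = true) (h₁ : ¬ (upB t = true ∧ loB u = true)) (h₂ : ¬ (loB t = true ∧ upB u = true)) :
    4 ≤ eqCount t + eqCount u := by
  have h1 := List.all_eq_true.mp link_pairs_bool α (by cases α <;> simp)
  have h2 := List.all_eq_true.mp h1 β (by cases β <;> simp)
  have h4 := List.all_eq_true.mp (List.all_eq_true.mp h2 t ht) u hu
  rw [hX] at h4
  simp only [Bool.not_true, Bool.false_or, Bool.or_eq_true, Bool.and_eq_true, decide_eq_true_eq] at h4
  rcases h4.2 with (h | h) | h
  · exact absurd h h₁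
  · exact absurd h h₂
  · exact h

/-- the sheets of the cap codes. [formal bookkeeping] -/
theorem linkSite_fst_of_up (α β : Bool) (i : Fin 12) (h : 6 ≤ i.val) (h' : i.val ≤ 8) : (linkSite α β i).1 = 1 := by
  revert h h'; revert α β i; decide

/-- the sheets of the cap codes. [formal bookkeeping] -/
theorem linkSite_fst_of_lo (α β : Bool) (i : Fin 12) (h : 9 ≤ i.val) : (linkSite α β i).1 = -1 := by
  revert h; revert α β i; decide

/-- the first coordinates of the coded sites lie in the window `{−1, 0, 1}`. [formal bookkeeping] -/
theorem linkSite_fst (α β : Bool) (i : Fin 12) :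
    (linkSite α β i).1 = -1 ∨ (linkSite α β i).1 = 0 ∨ (linkSite α β i).1 = 1 := by
  revert α β i; decide

/-! ## ZU-3  Transport: an arbitrary vertex of an arbitrary Barlow graph -/

/-- the window site `y` (relative coordinates) placed at the vertex `v`: `(v.1 + y.1; v.2 + y.2)`. [this file, g79] -/
def shiftSite (v y : ℤ × ℤ × ℤ) : ℤ × ℤ × ℤ := (v.1 + y.1, v.2 + y.2)

/-- [formal bookkeeping] -/
private theorem loAdj_add_left (c p q : ℤ × ℤ) : LoAdj (c + p) (c + q) ↔ LoAdj p q := by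
  simp [LoAdj, add_assoc]

/-- [formal bookkeeping] -/
theorem crossAdj_add_left (t : Bool) (c p q : ℤ × ℤ) : CrossAdj t (c + p) (c + q) ↔ CrossAdj t p q := by
  simp [CrossAdj, add_assoc]

/-- ★ every Barlow neighbour of `v` is a coded link site placed at `v` (letters: `τ (v.1 − 1)` below, `τ v.1` above). [this file, g79] -/
theorem exists_code_of_barlowAdj {τ : ℤ → Bool} {v x : ℤ × ℤ × ℤ} (h : BarlowAdj τ v x) :
    ∃ i : Fin 12, x = shiftSite v (linkSite (τ (v.1 - 1)) (τ v.1) i) := by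
  obtain ⟨k, c⟩ := v
  obtain ⟨a, p⟩ := x
  rcases h with ⟨h1, j, hj⟩ | ⟨h1, i, hi⟩ | ⟨h1, i, hi⟩
  · refine ⟨⟨j.val, by omega⟩, ?_⟩
    simp only at h1 hj
    simp only [shiftSite, linkSite, j.isLt, dif_pos, Fin.eta]
    ext <;> simp [h1, hj]
  · refine ⟨⟨6 + i.val, by omega⟩, ?_⟩
    simp only at h1 hi
    have h6 : ¬ (6 + i.val < 6) := by omega
    have h9 : 6 + i.val < 9 := by omega
    have hi' : (⟨6 + i.val - 6, by omega⟩ : Fin 3) = i := by ext; simp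
    simp only [shiftSite, linkSite, h6, h9, dif_neg, dif_pos, not_false_eq_true, hi']
    ext <;> simp [h1, hi]
  · refine ⟨⟨9 + i.val, by omega⟩, ?_⟩
    simp only at h1 hi
    obtain rfl : a = k - 1 := by omega
    have h6 : ¬ (9 + i.val < 6) := by omega
    have h9 : ¬ (9 + i.val < 9) := by omega
    have hi' : (⟨9 + i.val - 9, by omega⟩ : Fin 3) = i := by ext; simp
    simp only [shiftSite, linkSite, h6, h9, dif_neg, not_false_eq_true, hi', Prod.mk.injEq]
    exact ⟨by ring, hi⟩

/-- ★ Barlow adjacency of two window sites placed at `v` is the relative adjacency with letters `τ (v.1 − 1)`, `τ v.1`. [this file, g79] -/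
theorem barlowAdj_shift_iff (τ : ℤ → Bool) (v y y' : ℤ × ℤ × ℤ) (hy : y.1 = -1 ∨ y.1 = 0 ∨ y.1 = 1)
    (hy' : y'.1 = -1 ∨ y'.1 = 0 ∨ y'.1 = 1) :
    BarlowAdj τ (shiftSite v y) (shiftSite v y') ↔ RelAdj (τ (v.1 - 1)) (τ v.1) y y' := by
  obtain ⟨k, c⟩ := v
  obtain ⟨a, p⟩ := y
  obtain ⟨a', p'⟩ := y'
  simp only at hy hy'
  have e1 : k + -1 = k - 1 := by ring
  have n1 : k ≠ k - 1 := by omega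
  have n2 : k - 1 ≠ k + 1 := by omega
  have n3 : k + 1 ≠ k - 1 := by omega
  have n4 : k - 1 ≠ k + 2 := by omega
  have n5 : k - 1 ≠ k := by omega
  have n6 : k + 1 ≠ k := by omega
  have n7 : k ≠ k + 1 := by omega
  rcases hy with rfl | rfl | rfl <;> rcases hy' with rfl | rfl | rfl <;>
    simp [BarlowAdj, RelAdj, shiftSite, loAdj_add_left, crossAdj_add_left, add_assoc, e1, n1, n2, n3, n4, n5, n6, n7]

/-- the coded adjacency IS Barlow adjacency of the placed sites. [this file, g79] -/
theorem barlowAdj_code_iff (τ : ℤ → Bool) (v : ℤ × ℤ × ℤ) (i j : Fin 12) :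
    BarlowAdj τ (shiftSite v (linkSite (τ (v.1 - 1)) (τ v.1) i)) (shiftSite v (linkSite (τ (v.1 - 1)) (τ v.1) j)) ↔
      linkAdj (τ (v.1 - 1)) (τ v.1) i j = true := by
  rw [barlowAdj_shift_iff τ v _ _ (linkSite_fst _ _ i) (linkSite_fst _ _ j), linkAdj, relAdjB_iff]

/-! ## ZU-4  The footprint theorem -/

/-- ★★★ **CHART FOOTPRINTS ARE CAPS, OR THE VERTEX IS A c-VERTEX.**  In the Barlow graph with letters `τ`, let `a, b, c` and `d, e, f` be neighbours of `v`
forming two triangles with no adjacency between the triangles.  Then EITHER `{a, b, c}` is the cap in sheet `v.1 + 1` and `{d, e, f}` the cap in sheet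
`v.1 − 1`, OR the other way round, OR `τ (v.1 − 1) = τ v.1` (the vertex is cuboctahedral: letter c).  Consequently a Barlow bond chart whose sheet
through `v` is not `v`'s own layer hexagon (so that its two cross triangles at `v` are not the two caps) can only pass through c-vertices: TRANSVERSE
CHARTING FORCES THE LETTER c, combinatorially. [this file, g79] -/
theorem chartFootprint_caps_or_c {τ : ℤ → Bool} {v a b c d e f : ℤ × ℤ × ℤ}
    (ha : BarlowAdj τ v a) (hb : BarlowAdj τ v b) (hc : BarlowAdj τ v c) (hd : BarlowAdj τ v d) (he : BarlowAdj τ v e) (hf : BarlowAdj τ v f)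
    (hab : BarlowAdj τ a b) (hac : BarlowAdj τ a c) (hbc : BarlowAdj τ b c) (hde : BarlowAdj τ d e) (hdf : BarlowAdj τ d f) (hef : BarlowAdj τ e f)
    (had : ¬ BarlowAdj τ a d) (hae : ¬ BarlowAdj τ a e) (haf : ¬ BarlowAdj τ a f) (hbd : ¬ BarlowAdj τ b d) (hbe : ¬ BarlowAdj τ b e)
    (hbf : ¬ BarlowAdj τ b f) (hcd : ¬ BarlowAdj τ c d) (hce : ¬ BarlowAdj τ c e) (hcf : ¬ BarlowAdj τ c f) :
    (a.1 = v.1 + 1 ∧ b.1 = v.1 + 1 ∧ c.1 = v.1 + 1 ∧ d.1 = v.1 - 1 ∧ e.1 = v.1 - 1 ∧ f.1 = v.1 - 1) ∨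
      (a.1 = v.1 - 1 ∧ b.1 = v.1 - 1 ∧ c.1 = v.1 - 1 ∧ d.1 = v.1 + 1 ∧ e.1 = v.1 + 1 ∧ f.1 = v.1 + 1) ∨ τ (v.1 - 1) = τ v.1 := by
  obtain ⟨ia, rfl⟩ := exists_code_of_barlowAdj ha
  obtain ⟨ib, rfl⟩ := exists_code_of_barlowAdj hb
  obtain ⟨ic, rfl⟩ := exists_code_of_barlowAdj hc
  obtain ⟨id, rfl⟩ := exists_code_of_barlowAdj hd
  obtain ⟨ie, rfl⟩ := exists_code_of_barlowAdj he
  obtain ⟨i_f, rfl⟩ := exists_code_of_barlowAdj hf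
  rw [barlowAdj_code_iff] at hab hac hbc hde hdf hef had hae haf hbd hbe hbf hcd hce hcf
  simp only [Bool.not_eq_true] at had hae haf hbd hbe hbf hcd hce hcf
  have hX : crossFreeB (τ (v.1 - 1)) (τ v.1) (ia, ib, ic) (id, ie, i_f) = true := by
    simp [crossFreeB, had, hae, haf, hbd, hbe, hbf, hcd, hce, hcf]
  have hup := linkSite_fst_of_up (τ (v.1 - 1)) (τ v.1)
  have hlo := linkSite_fst_of_lo (τ (v.1 - 1)) (τ v.1)
  rcases caps_of_noCross _ _ _ _ (mem_linkTris hab hac hbc) (mem_linkTris hde hdf hef) hX with ⟨h1, h2⟩ | ⟨h1, h2⟩ | h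
  · simp only [upB, loB, Bool.and_eq_true, decide_eq_true_eq] at h1 h2
    obtain ⟨⟨⟨ha1, ha2⟩, hb1, hb2⟩, hc1, hc2⟩ := h1
    obtain ⟨⟨hd1, he1⟩, hf1⟩ := h2
    have h3 := hup ia ha1 ha2; have h4 := hup ib hb1 hb2; have h5 := hup ic hc1 hc2
    have h6 := hlo id hd1; have h7 := hlo ie he1; have h8 := hlo i_f hf1
    refine Or.inl ⟨?_, ?_, ?_, ?_, ?_, ?_⟩ <;> simp only [shiftSite] <;> omega
  · simp only [upB, loB, Bool.and_eq_true, decide_eq_true_eq] at h1 h2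
    obtain ⟨⟨ha1, hb1⟩, hc1⟩ := h1
    obtain ⟨⟨⟨hd1, hd2⟩, he1, he2⟩, hf1, hf2⟩ := h2
    have h3 := hlo ia ha1; have h4 := hlo ib hb1; have h5 := hlo ic hc1
    have h6 := hup id hd1 hd2; have h7 := hup ie he1 he2; have h8 := hup i_f hf1 hf2
    refine Or.inr (Or.inl ⟨?_, ?_, ?_, ?_, ?_, ?_⟩) <;> simp only [shiftSite] <;> omega
  · exact Or.inr (Or.inr h)

end Summit.AtomisticToContinuum.Crystallization.Theorems.ChartedZeroExcessLayeredLatticeLiouville
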